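import Summits.ValiantsHypothesis.ValiantsHypothesis.Theorems.BarrierLeverAnchoredDoorHitsLowerPairsDefs

/-!
# Support item `AnchoredDoorHitsLowerPairs` (stmt-ValiantsHypothesis-22510), line `anchored-peeling`: stub 1 `stub_genericPoint`

Registered stub 1 (`Stmt.stub_genericPoint`) of the planner's skeleton
`Cruxes/AnchoredDoorHitsLowerPairs/Lines/anchored_peeling.lean` (valiant-natproofs-p1 g19, D-0145; lane val-np-p1): THE GENERIC
POINT — if the symbolic partition minor `symbolicDet s h r u w ∈ ℂ[θ, φ, ψ]` of the anchored door 𝔄_s is a nonzero polynomial,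
some complex parameter point hits the layout (`AnchoredHit s h r u w`). Proof: `MvPolynomial.map (eval p)` of the symbolic witness
is the numeric witness at `p` (`map_eval_symbolicWitness`), so `eval p (symbolicDet …)` is the numeric minor (`eval_symbolicDet`,
`RingHom.map_det` + `coeff_map`), and a polynomial over the infinite integral domain `ℂ` that vanishes at every point is zero
(`MvPolynomial.funext`). Statements are the verbatim Theorems-side copies in `…AnchoredDoorHitsLowerPairsDefs`.
Prover seat val-np-p1 gen 14. Definition-free; closes NO item (`--supports stmt-ValiantsHypothesis-22510`).

WHAT THIS IS NOT: not the content stub (`stub_symbolicNonvanishing` stays open); nothing on items 22510 / 19717 themselves, on crux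
stmt-ValiantsHypothesis-14610, or on `VP` versus `VNP`.
-/

set_option linter.dupNamespace false

namespace Summit.ValiantsHypothesis.ValiantsHypothesis.Theorems.BarrierLever.AnchoredPeeling

open Finset MvPolynomial

noncomputable section

variable {h : ℕ}

/-- Specialising the parameters: `map (eval p)` of the symbolic witness is the numeric member of 𝔄_s at the point `p`. -/
theorem map_eval_symbolicWitness (s h : ℕ) (p : Param h → ℂ) :
    MvPolynomial.map (MvPolynomial.eval p) (symbolicWitness s h) =
      anchoredWitness s h (fun α => p (Sum.inl α)) (fun α b => p (Sum.inr (Sum.inl (α, b))))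
        (fun α d => p (Sum.inr (Sum.inr (α, d)))) := by
  rw [symbolicWitness, anchoredWitness, map_prod]
  refine Finset.prod_congr rfl (fun α _ => ?_)
  simp only [map_add, map_one, map_mul, map_prod, MvPolynomial.map_C, MvPolynomial.map_X, MvPolynomial.eval_X]

/-- Evaluating the symbolic minor at a point gives the numeric partition minor of the corresponding member of 𝔄_s. -/
theorem eval_symbolicDet (s h r : ℕ) (u w : Fin r → Finset (Fin h)) (p : Param h → ℂ) :
    MvPolynomial.eval p (symbolicDet s h r u w) =
      (Matrix.of fun i j : Fin r => MvPolynomial.coeff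
        (∑ a ∈ u i, Finsupp.single (Fin.castAdd h a) 1 + ∑ c ∈ w j, Finsupp.single (Fin.natAdd h c) 1)
        (anchoredWitness s h (fun α => p (Sum.inl α)) (fun α b => p (Sum.inr (Sum.inl (α, b))))
          (fun α d => p (Sum.inr (Sum.inr (α, d)))))).det := by
  rw [symbolicDet, RingHom.map_det]
  congr 1
  ext i j
  rw [RingHom.mapMatrix_apply, Matrix.map_apply, Matrix.of_apply, Matrix.of_apply, ← MvPolynomial.coeff_map,
    map_eval_symbolicWitness]

/-- **Stub 1 — generic point (registered signature `Stmt.stub_genericPoint`).** A nonzero symbolic minor has a complex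
non-root. -/
theorem stub_genericPoint : Stmt.stub_genericPoint := by
  intro s h r u w hD
  by_contra hno
  apply hD
  haveI : Infinite ℂ := Infinite.of_injective ((↑) : ℕ → ℂ) Nat.cast_injective
  refine MvPolynomial.funext (fun p => ?_)
  rw [eval_symbolicDet, map_zero]
  by_contra hdet
  exact hno ⟨fun α => p (Sum.inl α), fun α b => p (Sum.inr (Sum.inl (α, b))), fun α d => p (Sum.inr (Sum.inr (α, d))), hdet⟩

/-- Corollary: the numeric minor at ANY point is the evaluation of the symbolic minor, so a hit at one point makes the symbolic
minor nonzero (the converse direction of the transfer; used to feed numeric certificates such as `…AnchoredDoorCubeBall` into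
the symbolic language). -/
theorem symbolicDet_ne_zero_of_hit (s h r : ℕ) (u w : Fin r → Finset (Fin h)) (p : Param h → ℂ)
    (hdet : (Matrix.of fun i j : Fin r => MvPolynomial.coeff
        (∑ a ∈ u i, Finsupp.single (Fin.castAdd h a) 1 + ∑ c ∈ w j, Finsupp.single (Fin.natAdd h c) 1)
        (anchoredWitness s h (fun α => p (Sum.inl α)) (fun α b => p (Sum.inr (Sum.inl (α, b))))
          (fun α d => p (Sum.inr (Sum.inr (α, d)))))).det ≠ 0) :
    symbolicDet s h r u w ≠ 0 := by
  intro hD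
  apply hdet
  rw [← eval_symbolicDet, hD, map_zero]

end

end Summit.ValiantsHypothesis.ValiantsHypothesis.Theorems.BarrierLever.AnchoredPeeling
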